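import Literature.AnabelianGeometry.EtaleTheta.Discharge.Sec3Thm37RatStdOfCnst
import Literature.AnabelianGeometry.SemiGraphs.CosetCategoriesFiniteAut
import HarnessLib

/-!
# [EtTh] Theorem 3.7 (ii), second clause, with the constant-field category `D^cnst := 𝓑(G_K)⁰` as printed

S. Mochizuki, *The étale theta function and its Frobenioid-theoretic manifestations*, Publ. RIMS **45**
(2009) [EtTh], §3: the setting PDF p. 72 (printed p. 298) "`D^cnst := B(Spec(K))⁰` — where the superscript
'0' denotes the full subcategory constituted by the connected objects …; the natural surjection `Π^tp_X ↠ G_K`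
determines a natural functor `D₀ → D^cnst`", and Thm. 3.7 (ii) PDF p. 79 with proof p. 80
[cite: MochizukiEtTh2009, Thm 3.7 (ii) p.79].

Proof-only (theorems only, no definitions; cell abc-iut, layer L2, node `EtTh:Thm3.7(ii)`, seat
abc-iut-w5-d250 gen 3; GAP-LEDGER row G-w5d250-1): `Discharge/Sec3Thm37RatStdOfCnst.lean` derived the input
"`Π^tp_X` acts trivially on `K^×/O_K^×`" of Thm. 3.7 (ii) from Prop. 3.4 (ii) relative to an ABSTRACT
constant-field functor `cnst : D₀ ⥤ D^cnst` (`Prop34Cnst`) plus the hypothesis `hfin` that the automorphism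
groups of `D^cnst` are torsion.  At the PRINTED `D^cnst = B(Spec K)⁰ ≃ 𝓑(G_K)⁰` — the tree's coset category
`CosetCat G_K` of abc-iut-L5-t2 (objects the open subgroups of the compact group `G_K`, i.e. the finite separable
extensions `L/K`) — `hfin` HOLDS: `Aut_{D^cnst}(Spec L) = Aut(L/K)` is finite (`CosetCat.isOfFinOrder_aut`,
`SemiGraphs/CosetCategoriesFiniteAut.lean`).  Hence `thm37_ii_ratStd_treeCatVocab_of_cosetCnst`: [EtTh] Thm. 3.7
(ii), second clause, at the canonical vocabulary and THE [FrdI] Def. 4.5 parameters, for a tempered Frobenioid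
whose Def. 3.3 (iii)/3.6 (i) data come with a constant-field functor to `𝓑(G)⁰`, `G` any compact topological
group, satisfying Prop. 3.4 (ii) (`Prop34Cnst`) — modulo `hBmon`/`hD`/`hnd`/`hrat` and the constant-line
properties `hLine`, `hInt` only.  HONEST FRAMING: refereed pre-IUT material ([EtTh] §3); nothing here bears on
[IUTchIII] Cor. 3.12; no statement is strengthened; typed ≠ proved — PROVED modulo the named inputs.
-/

namespace Literature.AnabelianGeometry.EtaleTheta

open CategoryTheory Opposite Literature.AlgebraicGeometry.Frobenioids Literature.AnabelianGeometry.SemiGraphs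

universe u₀ v₀ u₁ u v w

variable {D₀ : Type u₀} [Category.{v₀} D₀] {V : FrdIMonoidStub.{w}}
  {T : RealifiedDivisorMonoids (D₀ := D₀) V}
  {GK : Type u₁} [Group GK] [TopologicalSpace GK] [SeparatelyContinuousMul GK] [CompactSpace GK]
  {cnst : D₀ ⥤ CosetCat GK}
  {D : Type u} [Category.{v} D]

namespace TemperedFrobenioid

section General

variable {VD : FrdICatStub.{u, v, w} D} (C : TemperedFrobenioid T D VD)

/-- **`hKfix` at the printed `D^cnst = 𝓑(G_K)⁰`**: the pull-back along EVERY automorphism of `A ∈ Ob(D)` fixes the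
divisor of every constant rational function, given Prop. 3.4 (ii) relative to a constant-field functor
`D₀ → 𝓑(G)⁰`, `G` compact, and the constant-line properties `hLine`, `hInt` — the finite-order hypothesis of
`pullGp_cnst_eq_self_of_line_of_cnst` being automatic (`Aut(L/K)` finite). [cite: MochizukiEtTh2009, Thm 3.7 (ii) p.79] -/
theorem pullGp_cnst_eq_self_of_line_of_cosetCnst (hP : T.Prop34Cnst cnst) (A : D)
    (hLine : ∀ (Y : D₀ᵒᵖ) (g : Algebra.GrothendieckGroup (T.ΦR.obj Y)), g ∈ T.cnstR Y →
      ∃ r : T.ΦR.obj Y, g = Algebra.GrothendieckGroup.of r ∨ g = (Algebra.GrothendieckGroup.of r)⁻¹)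
    (hInt : ∀ Y : D₀ᵒᵖ, IsCancelMul (T.ΦR.obj Y)) (f : A ≅ A)
    (b : T.BΛ.obj (C.baseOp (op A))) (ξ : Algebra.GrothendieckGroup (C.Φ.carrier (op A)))
    (hb : b ∈ T.FΛ (C.baseOp (op A))) (hbξ : (b, ξ) ∈ C.ratFn (op A)) :
    pullGp C.divisorMonoid f.hom ξ = ξ :=
  C.pullGp_cnst_eq_self_of_line_of_cnst hP A hLine hInt f (CosetCat.isOfFinOrder_aut _ _) b ξ hb hbξ

end General

section TreeVocab

variable {IsRational IsStrictlyRational : (Dᵒᵖ ⥤ CommMonCat.{w}) → Prop}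
  (C₀ : TemperedFrobenioid T D (treeCatVocab D IsRational IsStrictlyRational))

/-- **[EtTh] Thm. 3.7 (ii), second clause, at the canonical vocabulary and THE [FrdI] Def. 4.5 parameters, with
`D^cnst = 𝓑(G_K)⁰` as printed** ("If, moreover, `Φ` is rational, then `C` is of rationally standard type"): for a
tempered Frobenioid over Def. 3.6 (i) data equipped with a constant-field functor `cnst : D₀ ⥤ 𝓑(G)⁰` (`G`
compact, e.g. `G_K`) satisfying Prop. 3.4 (ii) (`Prop34Cnst`), given `hBmon` ([FrdI] Thm. 5.2 preamble), `D` of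
FSMFF-type and `Φ` non-dilating (first clause), "`Φ` rational" at THE support (`hrat`), and the constant-line
properties `hLine`, `hInt` — the input "`Π^tp_X` acts trivially on `K^×/O_K^×`" being DERIVED
(`Sec3Thm37RatStdOfCnst`) and the finiteness of `Aut(L/K)` PROVED (`CosetCat.isOfFinOrder_aut`).
[cite: MochizukiEtTh2009, Thm 3.7 (ii) p.79] -/
theorem thm37_ii_ratStd_treeCatVocab_of_cosetCnst (hBmon : IsMonoidOn C₀.ratFnFunctor) (hD : IsOfFSMFFType D)
    (hnd : IsNonDilatingOn C₀.divisorMonoid)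
    (hrat : ∀ X : C₀.category,
      PreFrobenioidData.IsRational
        (PreFrobenioid.biratData (C₀.isFrobenioid_treeCatVocab_of_isMonoidOn hBmon)
          (PreFrobenioid.hasBiratSquares_of_isFrobenioid (C₀.isFrobenioid_treeCatVocab_of_isMonoidOn hBmon)))
        (S := PreFrobenioidData.ofFunctor C₀.divisorMonoid C₀.toElem) (fun a 𝔭 => PrimarySupp a 𝔭) X)
    (hP : T.Prop34Cnst cnst)
    (hLine : ∀ (Y : D₀ᵒᵖ) (g : Algebra.GrothendieckGroup (T.ΦR.obj Y)), g ∈ T.cnstR Y →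
      ∃ r : T.ΦR.obj Y, g = Algebra.GrothendieckGroup.of r ∨ g = (Algebra.GrothendieckGroup.of r)⁻¹)
    (hInt : ∀ Y : D₀ᵒᵖ, IsCancelMul (T.ΦR.obj Y)) :
    (PreFrobenioidData.ofFunctor C₀.divisorMonoid C₀.toElem).IsOfRationallyStandardType
      (PreFrobenioid.rsParams (C₀.isFrobenioid_treeCatVocab_of_isMonoidOn hBmon) fun a 𝔭 => PrimarySupp a 𝔭) :=
  C₀.thm37_ii_ratStd_treeCatVocab_of_cnst' hBmon hD hnd hrat hP hLine hInt fun Z φ =>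
    CosetCat.isOfFinOrder_aut Z φ

end TreeVocab

end TemperedFrobenioid

end Literature.AnabelianGeometry.EtaleTheta
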